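import Summits.KontsevichZagierPeriods.KontsevichZagierPeriods.Theorems.LinRedNormalFormArrangementNormalFormStubRebaseSimplePosOneFibreParSplit

/-!
# Stub `stub_rebaseSimplePosOne`, residual hypothesis `Hpar` (crux `ArrangementNormalForm`,
line `janus-bands`, v6.2) — sub-part `ParPiece`

One PIECE of a sheared thin parallel band through the whole UNFOLD–EXCHANGE chain
(`RebasePos.unfold_cycle` + `RebasePos.exchange_split`):
* `RebasePos.thin_piece` — the chain for abstract output data `(M₃, A, Bf)`;
* `RebasePos.piece_good` — the chain for a LITERAL piece of the sheared band: domain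
  `{x'-rows M₀, y-free rows Mc, ylo(x') < y < yhi(x'), tlo(x') < t' < thi(x')}` (all forms
  `y`-free), integrand `R(x')/(y − ℓ₂(x')) · 1/(t' + u(x', y))`, on which the sign of
  `t' + κ'(x')` (`κ' = u₀ + s ℓ₂`, i.e. the ORDER of `τ = −(t' + u₀)/s` and `ℓ₂`) is constant
  (`hsgn`). The output rows are the same `y`-free forms read on the base `(x', t')` plus the two
  `t'`-bounds; `(A, Bf)` is `(τ, ℓ₂)` or `(ℓ₂, τ)` according to the signs of `s` and of `t' + κ'`;
  the legality "`y` never between `τ` and `ℓ₂`" comes from the side condition (B1)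
  (`hfloor`: `ℓ₂ ≤ ylo`, `u(x', ylo) ≥ 0` if `s > 0`; `yhi ≤ ℓ₂`, `u(x', yhi) ≥ 0` if `s < 0`)
  and `t' > 0`; the `y`-range is NON-PINCHING (`hη`).
Registered as `rebaseSimplePos_pieceGood`.

References: M. Kontsevich, D. Zagier, *Periods* (2001), §1.2.
-/

noncomputable section

open Set MeasureTheory MvPolynomial
open Literature.NumberTheory.Transcendental Literature.ModelTheory.ExponentialFields

namespace Summit.KontsevichZagierPeriods.ArrangementNormalForm.JanusBands

namespace RebasePos

open SeparatePos IntegrateOut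

section Piece

variable {B m : ℕ} (L : Fin m → (Fin B → ℚ) × ℚ) (e : Fin m → ℕ) (p₃ : MvPolynomial (Fin B) ℚ)
  (ℓ₁ ℓ₂ : (Fin B → ℚ) × ℚ) (u : (Fin (B + 1) → ℚ) × ℚ)

/-- **One piece through the whole chain** (abstract output data): `isBounded_outDom` +
`unfold_cycle` + `exchange_split`. -/
theorem thin_piece {m₃ : ℕ} (M₃ : Fin m₃ → (Fin (B + 1) → ℚ) × ℚ) (A Bf : (Fin (B + 1) → ℚ) × ℚ)
    (ylo yhi : (Fin B → ℚ) × ℚ) (s₂ : KZ.IntegralRep (B + 1 + 1))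
    (hd₂ : ∀ z, z ∈ s₂.domain ↔ (∀ j, 0 < ev (M₃ j) (Fin.snoc (fun i : Fin B => z (Fin.castAdd 1 (Fin.castSucc i)))
      (z (Fin.natAdd (B + 1) 0)) : Fin (B + 1) → ℝ)) ∧ affB B 1 ylo z < z (Fin.castAdd 1 (Fin.last B)) ∧
      z (Fin.castAdd 1 (Fin.last B)) < affB B 1 yhi z)
    (hi₂ : EqOn s₂.integrand (glit B 1 p₃ L e ℓ₁ ℓ₂ 0 1 (fun _ => some (-u))) s₂.domain)
    (hbd₂ : Bornology.IsBounded s₂.domain) (hs : u.1 (Fin.last B) ≠ 0)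
    (hABset : (A = ((Fin.snoc (fun i : Fin B => -u.1 (Fin.castSucc i) / u.1 (Fin.last B))
        (-1 / u.1 (Fin.last B)) : Fin (B + 1) → ℚ), -u.2 / u.1 (Fin.last B)) ∧
        Bf = ((Fin.snoc ℓ₂.1 0 : Fin (B + 1) → ℚ), ℓ₂.2)) ∨
      (A = ((Fin.snoc ℓ₂.1 0 : Fin (B + 1) → ℚ), ℓ₂.2) ∧
        Bf = ((Fin.snoc (fun i : Fin B => -u.1 (Fin.castSucc i) / u.1 (Fin.last B))
        (-1 / u.1 (Fin.last B)) : Fin (B + 1) → ℚ), -u.2 / u.1 (Fin.last B))))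
    (hABo : ∀ w : Fin (B + 1 + 1) → ℝ, (∀ j, 0 < affF B 1 (M₃ j) w) → affF B 1 A w < affF B 1 Bf w)
    (hlegO : (∀ w : Fin (B + 1 + 1) → ℝ, (∀ j, 0 < affF B 1 (M₃ j) w) → affF B 1 Bf w ≤ affB B 1 ylo w) ∨
      (∀ w : Fin (B + 1 + 1) → ℝ, (∀ j, 0 < affF B 1 (M₃ j) w) → affB B 1 yhi w ≤ affF B 1 A w))
    (hη : ∃ η : ℝ, 0 < η ∧ ∀ w : Fin (B + 1 + 1) → ℝ, (∀ j, 0 < affF B 1 (M₃ j) w) →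
      η ≤ affB B 1 yhi w - affB B 1 ylo w) :
    ∃ c ∈ AddSubgroup.closure (GGset B 2 1), KZ.of s₂ - c ∈ KZ.relations := by
  obtain ⟨η, hη0, hη'⟩ := hη
  have hbdO := isBounded_outDom s₂ M₃ A Bf ylo yhi hbd₂ hd₂ fun w hw => by have := hη' w hw; linarith
  obtain ⟨U', hU'd, hU'i, hrel⟩ := unfold_cycle L e p₃ ℓ₁ ℓ₂ u M₃ A Bf ylo yhi s₂ hd₂ hi₂ hs hABset hABo hlegO
  obtain ⟨c, hc, hcr⟩ := exchange_split L e p₃ ℓ₂ u M₃ A Bf ylo yhi U' hU'd hU'i hs hABset hbdO hlegO ⟨η, hη0, hη'⟩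
  refine ⟨c, hc, ?_⟩
  have : KZ.of s₂ - c = (KZ.of s₂ - KZ.of U') + (KZ.of U' - c) := by abel
  rw [this]
  exact add_mem hrel hcr

/-- A `y`-free full-base form read at an output point equals its `x'`-part. -/
theorem affF_yfree (c : (Fin (B + 1) → ℚ) × ℚ) (hc : c.1 (Fin.last B) = 0) (w : Fin (B + 1 + 1) → ℝ) :
    affF B 1 c w = affB B 1 (restr B c) w := by
  rw [affF_split c w, hc, Rat.cast_zero, zero_mul, zero_add]

/-- A `y`-free full-base form on a base vector with the `x'`-slots of `z` (any last entry). -/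
theorem ev_yfree_snoc (c : (Fin (B + 1) → ℚ) × ℚ) (hc : c.1 (Fin.last B) = 0) (z : Fin (B + 1 + 1) → ℝ) (t : ℝ) :
    ev c (Fin.snoc (fun i : Fin B => z (Fin.castAdd 1 (Fin.castSucc i))) t : Fin (B + 1) → ℝ) = affF B 1 c z := by
  rw [affF_yfree c hc]
  simp only [ev, affB, restr, Fin.sum_univ_castSucc, Fin.snoc_castSucc, Fin.snoc_last, hc, Rat.cast_zero, zero_mul,
    add_zero]

/-- The lifted `x'`-row on a base vector with the `x'`-slots of `z`. -/
theorem ev_liftB_snoc (d : (Fin B → ℚ) × ℚ) (z : Fin (B + 1 + 1) → ℝ) (t : ℝ) :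
    ev (((Fin.snoc d.1 0 : Fin (B + 1) → ℚ), d.2)) (Fin.snoc (fun i : Fin B => z (Fin.castAdd 1 (Fin.castSucc i))) t :
      Fin (B + 1) → ℝ) = affB B 1 d z := by
  simp only [ev, affB, Fin.sum_univ_castSucc, Fin.snoc_castSucc, Fin.snoc_last, Rat.cast_zero, zero_mul, add_zero]

/-- The row "`t' − tlo(x') > 0`" on a base vector with the `x'`-slots of `z` and last entry `t`. -/
theorem ev_rowLo_snoc (c : (Fin (B + 1) → ℚ) × ℚ) (hc : c.1 (Fin.last B) = 0) (z : Fin (B + 1 + 1) → ℝ) (t : ℝ) :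
    ev (((Fin.snoc (fun i : Fin B => -c.1 (Fin.castSucc i)) 1 : Fin (B + 1) → ℚ), -c.2))
      (Fin.snoc (fun i : Fin B => z (Fin.castAdd 1 (Fin.castSucc i))) t : Fin (B + 1) → ℝ) = t - affF B 1 c z := by
  rw [affF_yfree c hc]
  simp only [ev, affB, restr, Fin.sum_univ_castSucc, Fin.snoc_castSucc, Fin.snoc_last, Rat.cast_neg, Rat.cast_one,
    neg_mul, Finset.sum_neg_distrib, one_mul]
  ring

/-- The row "`thi(x') − t' > 0`" on a base vector with the `x'`-slots of `z` and last entry `t`. -/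
theorem ev_rowHi_snoc (c : (Fin (B + 1) → ℚ) × ℚ) (hc : c.1 (Fin.last B) = 0) (z : Fin (B + 1 + 1) → ℝ) (t : ℝ) :
    ev (((Fin.snoc (fun i : Fin B => c.1 (Fin.castSucc i)) (-1) : Fin (B + 1) → ℚ), c.2))
      (Fin.snoc (fun i : Fin B => z (Fin.castAdd 1 (Fin.castSucc i))) t : Fin (B + 1) → ℝ) = affF B 1 c z - t := by
  rw [affF_yfree c hc]
  simp only [ev, affB, restr, Fin.sum_univ_castSucc, Fin.snoc_castSucc, Fin.snoc_last, Rat.cast_neg, Rat.cast_one,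
    neg_mul, one_mul]
  ring

/-- The row "`t' − tlo(x') > 0`" read at an output point. -/
theorem affF_rowLo (c : (Fin (B + 1) → ℚ) × ℚ) (hc : c.1 (Fin.last B) = 0) (w : Fin (B + 1 + 1) → ℝ) :
    affF B 1 (((Fin.snoc (fun i : Fin B => -c.1 (Fin.castSucc i)) 1 : Fin (B + 1) → ℚ), -c.2)) w =
      w (Fin.castAdd 1 (Fin.last B)) - affF B 1 c w := by
  rw [← ev_base, ev_rowLo_snoc c hc]

/-- The row "`thi(x') − t' > 0`" read at an output point. -/
theorem affF_rowHi (c : (Fin (B + 1) → ℚ) × ℚ) (hc : c.1 (Fin.last B) = 0) (w : Fin (B + 1 + 1) → ℝ) :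
    affF B 1 (((Fin.snoc (fun i : Fin B => c.1 (Fin.castSucc i)) (-1) : Fin (B + 1) → ℚ), c.2)) w =
      affF B 1 c w - w (Fin.castAdd 1 (Fin.last B)) := by
  rw [← ev_base, ev_rowHi_snoc c hc]

/-- **One literal piece of the sheared thin band through the whole chain.** See the module
docstring. -/
theorem piece_good {m₀ mc : ℕ} (M₀ : Fin m₀ → (Fin B → ℚ) × ℚ) (ylo yhi : (Fin B → ℚ) × ℚ)
    (sP : KZ.IntegralRep (B + 1 + 1)) (Mc : Fin mc → (Fin (B + 1) → ℚ) × ℚ)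
    (hMc : ∀ j, (Mc j).1 (Fin.last B) = 0) (tloF thiF : (Fin (B + 1) → ℚ) × ℚ)
    (htlo : tloF.1 (Fin.last B) = 0) (hthi : thiF.1 (Fin.last B) = 0)
    (hdP : ∀ z, z ∈ sP.domain ↔ ((∀ j, 0 < affB B 1 (M₀ j) z) ∧ (∀ j, 0 < affF B 1 (Mc j) z) ∧
      affB B 1 ylo z < z (Fin.castAdd 1 (Fin.last B)) ∧ z (Fin.castAdd 1 (Fin.last B)) < affB B 1 yhi z) ∧
      affF B 1 tloF z < z (Fin.natAdd (B + 1) 0) ∧ z (Fin.natAdd (B + 1) 0) < affF B 1 thiF z)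
    (hiP : EqOn sP.integrand (glit B 1 p₃ L e ℓ₁ ℓ₂ 0 1 (fun _ => some (-u))) sP.domain)
    (hbdP : Bornology.IsBounded sP.domain) (hs : u.1 (Fin.last B) ≠ 0)
    (ht0 : ∀ z : Fin (B + 1 + 1) → ℝ, (∀ j, 0 < affF B 1 (Mc j) z) → 0 ≤ affF B 1 tloF z)
    (hsgn : (∀ (z : Fin (B + 1 + 1) → ℝ) (t : ℝ), (∀ j, 0 < affF B 1 (Mc j) z) → affF B 1 tloF z < t →
        t < affF B 1 thiF z → 0 < t + (affB B 1 (restr B u) z + (u.1 (Fin.last B) : ℝ) * affB B 1 ℓ₂ z)) ∨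
      (∀ (z : Fin (B + 1 + 1) → ℝ) (t : ℝ), (∀ j, 0 < affF B 1 (Mc j) z) → affF B 1 tloF z < t →
        t < affF B 1 thiF z → t + (affB B 1 (restr B u) z + (u.1 (Fin.last B) : ℝ) * affB B 1 ℓ₂ z) < 0))
    (hη : ∃ η : ℝ, 0 < η ∧ ∀ z : Fin (B + 1 + 1) → ℝ, (∀ j, 0 < affB B 1 (M₀ j) z) →
      η ≤ affB B 1 yhi z - affB B 1 ylo z)
    (hfloor : ∀ z : Fin (B + 1 + 1) → ℝ, (∀ j, 0 < affB B 1 (M₀ j) z) →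
      (0 < u.1 (Fin.last B) → affB B 1 ℓ₂ z ≤ affB B 1 ylo z ∧
        0 ≤ (u.1 (Fin.last B) : ℝ) * affB B 1 ylo z + affB B 1 (restr B u) z) ∧
      (u.1 (Fin.last B) < 0 → affB B 1 yhi z ≤ affB B 1 ℓ₂ z ∧
        0 ≤ (u.1 (Fin.last B) : ℝ) * affB B 1 yhi z + affB B 1 (restr B u) z)) :
    ∃ c ∈ AddSubgroup.closure (GGset B 2 1), KZ.of sP - c ∈ KZ.relations := by
  -- the output rows: lifted `x'`-rows, the `y`-free rows, and the two `t'`-bounds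
  set rowLo : (Fin (B + 1) → ℚ) × ℚ := ((Fin.snoc (fun i : Fin B => -tloF.1 (Fin.castSucc i)) 1 : Fin (B + 1) → ℚ), -tloF.2)
    with hrowLo
  set rowHi : (Fin (B + 1) → ℚ) × ℚ := ((Fin.snoc (fun i : Fin B => thiF.1 (Fin.castSucc i)) (-1) : Fin (B + 1) → ℚ), thiF.2)
    with hrowHi
  set M₃ : Fin (m₀ + mc + 2) → (Fin (B + 1) → ℚ) × ℚ :=
    Fin.append (Fin.append (fun j => (((Fin.snoc (M₀ j).1 0 : Fin (B + 1) → ℚ), (M₀ j).2)) : Fin m₀ → _) Mc)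
      ![rowLo, rowHi] with hM₃
  have hrows_in : ∀ z : Fin (B + 1 + 1) → ℝ, (∀ j, 0 < ev (M₃ j) (Fin.snoc (fun i : Fin B => z (Fin.castAdd 1 (Fin.castSucc i)))
      (z (Fin.natAdd (B + 1) 0)) : Fin (B + 1) → ℝ)) ↔ ((∀ j, 0 < affB B 1 (M₀ j) z) ∧ (∀ j, 0 < affF B 1 (Mc j) z)) ∧
      affF B 1 tloF z < z (Fin.natAdd (B + 1) 0) ∧ z (Fin.natAdd (B + 1) 0) < affF B 1 thiF z := by
    intro z
    rw [hM₃, Fin.forall_fin_add, Fin.forall_fin_add, Fin.forall_fin_two]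
    simp only [Fin.append_left, Fin.append_right, Matrix.cons_val_zero, Matrix.cons_val_one,
      ev_liftB_snoc, ev_yfree_snoc _ (hMc _), hrowLo, hrowHi, ev_rowLo_snoc _ htlo, ev_rowHi_snoc _ hthi, sub_pos]
  have hrows_out : ∀ w : Fin (B + 1 + 1) → ℝ, (∀ j, 0 < affF B 1 (M₃ j) w) ↔
      ((∀ j, 0 < affB B 1 (M₀ j) w) ∧ (∀ j, 0 < affF B 1 (Mc j) w)) ∧
      affF B 1 tloF w < w (Fin.castAdd 1 (Fin.last B)) ∧ w (Fin.castAdd 1 (Fin.last B)) < affF B 1 thiF w := by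
    intro w
    rw [hM₃, Fin.forall_fin_add, Fin.forall_fin_add, Fin.forall_fin_two]
    simp only [Fin.append_left, Fin.append_right, Matrix.cons_val_zero, Matrix.cons_val_one, affF_liftB,
      hrowLo, hrowHi, affF_rowLo _ htlo, affF_rowHi _ hthi, sub_pos]
  have hd₂ : ∀ z, z ∈ sP.domain ↔ (∀ j, 0 < ev (M₃ j) (Fin.snoc (fun i : Fin B => z (Fin.castAdd 1 (Fin.castSucc i)))
      (z (Fin.natAdd (B + 1) 0)) : Fin (B + 1) → ℝ)) ∧ affB B 1 ylo z < z (Fin.castAdd 1 (Fin.last B)) ∧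
      z (Fin.castAdd 1 (Fin.last B)) < affB B 1 yhi z := fun z => by
    rw [hdP, hrows_in]
    tauto
  obtain ⟨η, hη0, hη'⟩ := hη
  have hηO : ∃ η : ℝ, 0 < η ∧ ∀ w : Fin (B + 1 + 1) → ℝ, (∀ j, 0 < affF B 1 (M₃ j) w) →
      η ≤ affB B 1 yhi w - affB B 1 ylo w :=
    ⟨η, hη0, fun w hw => hη' w ((hrows_out w).1 hw).1.1⟩
  -- the two candidate bounds of `σ`
  set sR : ℝ := (u.1 (Fin.last B) : ℝ) with hsR
  set Tf : (Fin (B + 1) → ℚ) × ℚ := ((Fin.snoc (fun i : Fin B => -u.1 (Fin.castSucc i) / u.1 (Fin.last B))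
    (-1 / u.1 (Fin.last B)) : Fin (B + 1) → ℚ), -u.2 / u.1 (Fin.last B)) with hTf
  set Lf : (Fin (B + 1) → ℚ) × ℚ := ((Fin.snoc ℓ₂.1 0 : Fin (B + 1) → ℚ), ℓ₂.2) with hLf
  have hTv : ∀ w : Fin (B + 1 + 1) → ℝ, affF B 1 Tf w = -(w (Fin.castAdd 1 (Fin.last B)) + affB B 1 (restr B u) w) / sR :=
    fun w => affF_Tform u w
  have hLv : ∀ w : Fin (B + 1 + 1) → ℝ, affF B 1 Lf w = affB B 1 ℓ₂ w := fun w => affF_liftB ℓ₂ w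
  have hs' : sR ≠ 0 := by rw [hsR]; exact_mod_cast hs
  have hdLT : ∀ w : Fin (B + 1 + 1) → ℝ, affF B 1 Lf w - affF B 1 Tf w =
      (w (Fin.castAdd 1 (Fin.last B)) + (affB B 1 (restr B u) w + sR * affB B 1 ℓ₂ w)) / sR := fun w => by
    rw [hTv, hLv]; field_simp; ring
  -- decoding of output-row points
  have hdec : ∀ w : Fin (B + 1 + 1) → ℝ, (∀ j, 0 < affF B 1 (M₃ j) w) →
      (∀ j, 0 < affB B 1 (M₀ j) w) ∧ (∀ j, 0 < affF B 1 (Mc j) w) ∧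
      affF B 1 tloF w < w (Fin.castAdd 1 (Fin.last B)) ∧ w (Fin.castAdd 1 (Fin.last B)) < affF B 1 thiF w ∧
      0 < w (Fin.castAdd 1 (Fin.last B)) := fun w hw => by
    obtain ⟨⟨h0, hc⟩, hlo, hhi⟩ := (hrows_out w).1 hw
    exact ⟨h0, hc, hlo, hhi, lt_of_le_of_lt (ht0 w hc) hlo⟩
  -- the four sign cases
  obtain ⟨A, Bf, hABset, hABo, hlegO⟩ : ∃ A Bf : (Fin (B + 1) → ℚ) × ℚ,
      ((A = Tf ∧ Bf = Lf) ∨ (A = Lf ∧ Bf = Tf)) ∧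
      (∀ w : Fin (B + 1 + 1) → ℝ, (∀ j, 0 < affF B 1 (M₃ j) w) → affF B 1 A w < affF B 1 Bf w) ∧
      ((∀ w : Fin (B + 1 + 1) → ℝ, (∀ j, 0 < affF B 1 (M₃ j) w) → affF B 1 Bf w ≤ affB B 1 ylo w) ∨
        (∀ w : Fin (B + 1 + 1) → ℝ, (∀ j, 0 < affF B 1 (M₃ j) w) → affB B 1 yhi w ≤ affF B 1 A w)) := by
    rcases lt_or_gt_of_ne hs with hneg | hpos
    · have hsn : sR < 0 := by rw [hsR]; exact_mod_cast hneg
      rcases hsgn with hsg | hsg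
      · -- `s < 0`, `t' + κ' > 0`: `τ > ℓ₂`, `y` below both
        refine ⟨Lf, Tf, Or.inr ⟨rfl, rfl⟩, fun w hw => ?_, Or.inr fun w hw => ?_⟩
        · obtain ⟨-, hc, hlo, hhi, -⟩ := hdec w hw
          have key := hsg w _ hc hlo hhi
          refine sub_pos.1 ?_
          rw [show affF B 1 Tf w - affF B 1 Lf w = -(affF B 1 Lf w - affF B 1 Tf w) by ring, hdLT, ← div_neg]
          exact div_pos key (neg_pos.2 hsn)
        · obtain ⟨h0, -, -, -, -⟩ := hdec w hw
          rw [hLv]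
          exact ((hfloor w h0).2 hneg).1
      · -- `s < 0`, `t' + κ' < 0`: `τ < ℓ₂`, `y` below both
        refine ⟨Tf, Lf, Or.inl ⟨rfl, rfl⟩, fun w hw => ?_, Or.inr fun w hw => ?_⟩
        · obtain ⟨-, hc, hlo, hhi, -⟩ := hdec w hw
          have key := hsg w _ hc hlo hhi
          refine sub_pos.1 ?_
          rw [hdLT]
          exact div_pos_iff.2 (Or.inr ⟨key, hsn⟩)
        · obtain ⟨h0, -, -, -, ht⟩ := hdec w hw
          obtain ⟨-, hfl⟩ := (hfloor w h0).2 hneg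
          rw [hTv, le_div_iff_of_neg hsn]
          linarith [mul_comm sR (affB B 1 yhi w)]
    · have hsp : 0 < sR := by rw [hsR]; exact_mod_cast hpos
      rcases hsgn with hsg | hsg
      · -- `s > 0`, `t' + κ' > 0`: `τ < ℓ₂`, `y` above both
        refine ⟨Tf, Lf, Or.inl ⟨rfl, rfl⟩, fun w hw => ?_, Or.inl fun w hw => ?_⟩
        · obtain ⟨-, hc, hlo, hhi, -⟩ := hdec w hw
          have key := hsg w _ hc hlo hhi
          refine sub_pos.1 ?_
          rw [hdLT]
          exact div_pos key hsp
        · obtain ⟨h0, -, -, -, -⟩ := hdec w hw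
          rw [hLv]
          exact ((hfloor w h0).1 hpos).1
      · -- `s > 0`, `t' + κ' < 0`: `τ > ℓ₂`, `y` above both
        refine ⟨Lf, Tf, Or.inr ⟨rfl, rfl⟩, fun w hw => ?_, Or.inl fun w hw => ?_⟩
        · obtain ⟨-, hc, hlo, hhi, -⟩ := hdec w hw
          have key := hsg w _ hc hlo hhi
          refine sub_pos.1 ?_
          rw [show affF B 1 Tf w - affF B 1 Lf w = -(affF B 1 Lf w - affF B 1 Tf w) by ring, hdLT, ← neg_div]
          exact div_pos (neg_pos.2 key) hsp
        · obtain ⟨h0, -, -, -, ht⟩ := hdec w hw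
          obtain ⟨-, hfl⟩ := (hfloor w h0).1 hpos
          rw [hTv, div_le_iff₀ hsp]
          linarith [mul_comm sR (affB B 1 ylo w)]
  exact thin_piece L e p₃ ℓ₁ ℓ₂ u M₃ A Bf ylo yhi sP hd₂ hiP hbdP hs hABset hABo hlegO hηO

end Piece

end RebasePos

/-- **Registered support goal of this file: one literal piece of the sheared thin band through
the UNFOLD–EXCHANGE chain** (`RebasePos.piece_good`): over `x'`-rows `M₀`, `y`-free rows `Mc`,
`y`-section `(ylo, yhi)` non-pinching, `t'`-bounds `tlo ≥ 0`, `thi`, with a constant sign of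
`t' + u₀(x') + s ℓ₂(x')` and the side condition (B1) (`hfloor`), the piece is congruent modulo
`KZ.relations` to the subgroup generated by the literal class `GG B 2 1`. -/
theorem rebaseSimplePos_pieceGood (B m m₀ mc : ℕ) (L : Fin m → (Fin B → ℚ) × ℚ) (e : Fin m → ℕ) (p₃ : MvPolynomial (Fin B) ℚ) (ℓ₁ ℓ₂ : (Fin B → ℚ) × ℚ) (u : (Fin (B + 1) → ℚ) × ℚ) (M₀ : Fin m₀ → (Fin B → ℚ) × ℚ) (ylo yhi : (Fin B → ℚ) × ℚ) (sP : KZ.IntegralRep (B + 1 + 1)) (Mc : Fin mc → (Fin (B + 1) → ℚ) × ℚ) (hMc : ∀ j, (Mc j).1 (Fin.last B) = 0) (tloF thiF : (Fin (B + 1) → ℚ) × ℚ) (htlo : tloF.1 (Fin.last B) = 0) (hthi : thiF.1 (Fin.last B) = 0) (hdP : ∀ z, z ∈ sP.domain ↔ ((∀ j, 0 < SeparatePos.affB B 1 (M₀ j) z) ∧ (∀ j, 0 < SeparatePos.affF B 1 (Mc j) z) ∧ SeparatePos.affB B 1 ylo z < z (Fin.castAdd 1 (Fin.last B)) ∧ z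 (Fin.castAdd 1 (Fin.last B)) < SeparatePos.affB B 1 yhi z) ∧ SeparatePos.affF B 1 tloF z < z (Fin.natAdd (B + 1) 0) ∧ z (Fin.natAdd (B + 1) 0) < SeparatePos.affF B 1 thiF z) (hiP : Set.EqOn sP.integrand (RebasePos.glit B 1 p₃ L e ℓ₁ ℓ₂ 0 1 (fun _ => some (-u))) sP.domain) (hbdP : Bornology.IsBounded sP.domain) (hs : u.1 (Fin.last B) ≠ 0) (ht0 : ∀ z : Fin (B + 1 + 1) → ℝ, (∀ j, 0 < SeparatePos.affF B 1 (Mc j) z) → 0 ≤ SeparatePos.affF B 1 tloF z) (hsgn : (∀ (z : Fin (B + 1 + 1) → ℝ) (t : ℝ), (∀ j, 0 < SeparatePos.affF B 1 (Mc j) z) → SeparatePos.affF B 1 tloF z < t → t < SeparatePos.affF B 1 thiF z → 0 < t + (SeparatePos.affB B 1 (SeparatePos.restr B u) z + (u.1 (Fin.last B) : ℝ) * SeparatePos.affB B 1 ℓ₂ z)) ∨ (∀ (z : Fin (B + 1 + 1) → ℝ) (t : ℝ), (∀ j, 0 < SeparatePos.affF B 1 (Mc j) z) → SeparatePos.affF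 B 1 tloF z < t → t < SeparatePos.affF B 1 thiF z → t + (SeparatePos.affB B 1 (SeparatePos.restr B u) z + (u.1 (Fin.last B) : ℝ) * SeparatePos.affB B 1 ℓ₂ z) < 0)) (hη : ∃ η : ℝ, 0 < η ∧ ∀ z : Fin (B + 1 + 1) → ℝ, (∀ j, 0 < SeparatePos.affB B 1 (M₀ j) z) → η ≤ SeparatePos.affB B 1 yhi z - SeparatePos.affB B 1 ylo z) (hfloor : ∀ z : Fin (B + 1 + 1) → ℝ, (∀ j, 0 < SeparatePos.affB B 1 (M₀ j) z) → (0 < u.1 (Fin.last B) → SeparatePos.affB B 1 ℓ₂ z ≤ SeparatePos.affB B 1 ylo z ∧ 0 ≤ (u.1 (Fin.last B) : ℝ) * SeparatePos.affB B 1 ylo z + SeparatePos.affB B 1 (SeparatePos.restr B u) z) ∧ (u.1 (Fin.last B) < 0 → SeparatePos.affB B 1 yhi z ≤ SeparatePos.affB B 1 ℓ₂ z ∧ 0 ≤ (u.1 (Fin.last B) : ℝ) * SeparatePos.affB B 1 yhi z + SeparatePos.affB B 1 (SeparatePos.restr B u) z)) : ∃ c ∈ AddSubgroup.closure (SeparatePos.GGset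 B 2 1), KZ.of sP - c ∈ KZ.relations :=
  RebasePos.piece_good L e p₃ ℓ₁ ℓ₂ u M₀ ylo yhi sP Mc hMc tloF thiF htlo hthi hdP hiP hbdP hs ht0 hsgn hη hfloor

end Summit.KontsevichZagierPeriods.ArrangementNormalForm.JanusBands
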